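import Literature.NumberTheory.ConnesConsani2021.QuasiInnerPrimeResidues
import Literature.NumberTheory.ConnesConsani2021.QuasiInnerArchResidues
import Literature.NumberTheory.ConnesConsani2021.QuasiInnerPrimeNotCompact
import HarnessLib

/-!
# Connes–Consani 2021 (JNT) §3 — display «offdiag2» and Lemma 3.5 PROVED

LINE 1 — LABEL: RH-FREE corpus literature (the off-diagonal part `(1 − 𝒫)κ_p𝒫` of the ratio of
non-archimedean local factors transported to the circle: a strongly convergent series of rank-one
operators and a bounded-operator factorisation); bears_on: W-C/W-P (P5 sequel vocabulary, no leaf role);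
WHAT THIS IS NOT: any claim about RH — nothing in this file bears on the truth of RH.

Source: A. Connes, C. Consani, *Quasi-inner functions and local factors*, J. Number Theory **226**
(2021) 139–167 = arXiv:2008.10974 [bib: `ConnesConsani2021QuasiInner`], §3, arXiv chunks
p0008:L21–L75 (display «offdiag2») and p0008:L131–p0009:L32 (Lemma 3.5 and its proof).
Vocabulary = seat t17's `QuasiInnerLocalFactors.lean` (`hardyOffDiag`, `kappaPrime`, `xiVec`, `etaVec`,
`xPrime`, `zetaVec`, `hardyIsoPlus/Minus`, the named facts `display_offdiag2`, `lemma_3_5`); the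
change of variables `S¹ → ∂ℂ₋` is t17's `fourierCoeff_circleRestrict_neg_eq_integral`
(`QuasiInnerArchResidues.lean`) and the residue computation is `hasSum_residues_rhoPrime_kernel`
(`QuasiInnerPrimeResidues.lean`). THEOREMS ONLY (no definition, no named fact).

## Content (RH-FREE) — the printed argument, formalized as printed

«Next, we compute the Fourier coefficients of the function `κ_p(v) := ρ_p(½ + (v+1)/(v−1))` for `k > 0`
… `a^{(p)}_{−k} = 8(1 − 1/p) log p Σ_ℤ (4πn + 3i log p)^{−2} x_p(n)^{k−1}` and … we obtain the equality
`(1 − 𝒫)κ_p𝒫 = 8(1 − 1/p) log p Σ_ℤ (4πn + 3i log p)^{−2}(1 − 𝒫)f_{x_p(n)}𝒫`. By Lemma 2.2 this gives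
(offdiag2) `(1 − 𝒫)κ_p𝒫 = 8(1 − 1/p) log p Σ_ℤ (4πn + 3i log p)^{−2}|ξ_{x_p(n)}⟩⟨η_{x_p(n)}|`.»
(p0008:L21–L75) — and Lemma 3.5: «`(1 − 𝒫)κ_p𝒫 = ((1−p)/p) U_− V I V^* U_+^*`», proved in print from
`(2^{3/2}(log p)^{1/2}/(4πn + 3i log p)) ξ_{x_p(n)} = U_−(ζ_n)`, `−(2^{3/2}(log p)^{1/2}/(4πn − 3i log p))
η_{x_p(n)} = U_+(ζ_{−n})`, `I = Σ_ℤ |δ_n⟩⟨δ_{−n}|` (p0008:L137–p0009:L32).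

* `hasSum_fourierCoeff_kappaPrime_neg` — the NEGATIVE FOURIER COEFFICIENTS of `κ_p|_{S¹}`:
  `κ̂_p(−(j+1)) = Σ_{n∈ℤ} 8(1 − p⁻¹) log p (4πn + 3i log p)⁻² x_p(n)^j` (t17's change of variables +
  `hasSum_residues_rhoPrime_kernel`).
* `hardyIsoMinus_zetaVec`, `hardyIsoPlus_zetaVec` — the two printed vector identities
  `U_−(ζ_n) = (√(8 log p)/(4πn + 3i log p)) ξ_{x_p(n)}`, `U_+(ζ_n) = (√(8 log p)/(4πn + 3i log p)) η_{x_p(−n)}`.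
* `hasSum_rankOne_primeModel` — for ANY bounded `V` with `Vδ_n = ζ_n` and ANY bounded `I` with
  `Iδ_n = δ_{−n}`, the series `Σ_ℤ 8(1 − p⁻¹) log p (4πn + 3i log p)⁻²|ξ_{x_p(n)}⟩⟨η_{x_p(n)}| f` converges
  (strongly, for every `f ∈ L²(S¹)`) to `((1−p)/p) U_− V I V^* U_+^* f` (expand `V^*U_+^*f = Σ w(n)δ_n` in
  `ℓ²(ℤ)` and push through the bounded `U_− V I`).
* `lemma_3_5_holds : lemma_3_5` — **Lemma 3.5 PROVED** (both sides are bounded and have the same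
  matrix in the Fourier basis: `⟨e_{−k−1}|(1 − 𝒫)κ_p𝒫 e_b⟩ = κ̂_p(−k−b−1)` for `b ≥ 0`, all other
  entries `0`; the model's entries are `Σ_n c_n x_p(n)^{k+b}` by the strong expansion).
* `display_offdiag2_holds : display_offdiag2` — **display «offdiag2» PROVED** (Lemma 3.5 + the strong
  expansion, with `V` from the landed `lemma_3_4_holds` and `I` the flip isometry of `ℓ²(ℤ)`).
* `fact_3_6_holds : fact_3_6` — **Fact 3.6 («`ρ_p` is not quasi-inner») PROVED**: seat t17's landed
  reduction `fact_3_6_of_lemma_3_5` (`QuasiInnerPrimeNotCompact.lean`) applied to `lemma_3_5_holds`.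
* `hasSum_rankOne_primeModel_diag`, `hasSum_rankOne_primeModel_rhoArchDiag` — the same strong
  expansion with a bounded DIAGONAL factor `D` inserted (`Dδ_n = d_nδ_n`): `((1−p)/p)U_−VDIV^*U_+^* f =
  Σ_n d_n c_n|ξ_{x_p(n)}⟩⟨η_{x_p(n)}| f`; with the printed `Dδ_0 = 0`, `Dδ_n = ρ_∞(2πin/log p)δ_n` this is
  the term `ℰ_p` of Theorem 4.4 (ii) (input for row t18's named fact `thm_4_4_ii`).

Nothing in this file bears on the truth of RH.
-/

noncomputable section

open _root_.MeasureTheory _root_.Complex AddCircle Filter Set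
open scoped Real ENNReal InnerProductSpace Topology ComplexConjugate

namespace Literature.NumberTheory.ConnesConsani2021

namespace QuasiInner

/-! ### The negative Fourier coefficients of `κ_p` -/

section FourierCoefficients

/-- On the critical line `z = ½ + it` (where `ψ⁻¹(z) = e^{2πix}`, `x = ½ + arctan(t)/π`):
`π⁻¹(1 + t²)⁻¹ ψ⁻¹(z)^{j+1} κ_p(ψ⁻¹(z)) = (1/2π)·ρ_p(z) ψ⁻¹(z)^j (−8)/(2z − 3)²` — the integrand identity
«implementing the differential `dψ⁻¹(z) = −8(2z−3)⁻² dz`».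
[cite: ConnesConsani2021QuasiInner, §3 (arXiv chunk p0008:L24) with §2 (p0005:L34–L44)] -/
private theorem kappaPrime_integrand_eq (p : ℕ) (j : ℕ) (t : ℝ) :
    (((π⁻¹ * (1 + t ^ 2)⁻¹ : ℝ)) : ℂ) *
        (cayleyInv (1 / 2 + t * I) ^ (j + 1) * kappaPrime p (cayleyInv (1 / 2 + t * I))) =
      (1 / (2 * π) : ℂ) * (rhoPrime p (1 / 2 + t * I) *
        (cayleyInv (1 / 2 + t * I) ^ j * ((-8 : ℂ) / (2 * (1 / 2 + t * I) - 3) ^ 2))) := by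
  set z : ℂ := 1 / 2 + (t : ℂ) * I with hzdef
  have hz : z ≠ 3 / 2 := by
    intro h
    have := congrArg Complex.re h
    rw [hzdef] at this
    simp at this
    norm_num at this
  rw [kappaPrime, cayley_cayleyInv hz]
  have hB0 : (2 * z - 3 : ℂ) ≠ 0 := by
    intro h
    have := congrArg Complex.re h
    rw [hzdef] at this
    norm_num at this
  have hπ : (π : ℂ) ≠ 0 := ofReal_ne_zero.mpr Real.pi_pos.ne'
  -- `(2z+1)(2z−3) = −4(1+t²)` on the critical line
  have hq : (((1 + t ^ 2 : ℝ)) : ℂ) = -((2 * z + 1) * (2 * z - 3)) / 4 := by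
    rw [hzdef]
    push_cast
    linear_combination ((t : ℂ) ^ 2) * I_sq
  have hq0 : (((1 + t ^ 2 : ℝ)) : ℂ) ≠ 0 := by
    exact_mod_cast (by positivity : (1 + t ^ 2 : ℝ) ≠ 0)
  have hA0 : (2 * z + 1 : ℂ) ≠ 0 := by
    intro h
    rw [h, zero_mul, neg_zero, zero_div] at hq
    exact hq0 hq
  have hcast : (((π⁻¹ * (1 + t ^ 2)⁻¹ : ℝ)) : ℂ) = (π : ℂ)⁻¹ * ((((1 + t ^ 2 : ℝ)) : ℂ))⁻¹ := by
    push_cast; ring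
  rw [hcast, hq, pow_succ, cayleyInv]
  field_simp
  ring

/-- **The negative Fourier coefficients of `κ_p|_{S¹}`** («`a^{(p)}_{−k} = 8(1 − 1/p) log p
Σ_ℤ (4πn + 3i log p)^{−2} x_p(n)^{k−1}`», `k = j + 1 ≥ 1`), as a convergent series over `ℤ`:
t17's change of variables `S¹ → ∂ℂ₋` (`fourierCoeff_circleRestrict_neg_eq_integral`) followed by the
residue computation `hasSum_residues_rhoPrime_kernel`.
[cite: ConnesConsani2021QuasiInner, §3 (arXiv chunk p0008:L21–L64)] -/
theorem hasSum_fourierCoeff_kappaPrime_neg {p : ℕ} (hp : p.Prime) (j : ℕ) :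
    HasSum (fun n : ℤ => 8 * (1 - (p : ℂ)⁻¹) * Real.log p / (4 * π * n + 3 * I * Real.log p) ^ 2 *
        xPrime p n ^ j)
      (fourierCoeff (T := 1) (circleRestrict 1 (kappaPrime p)) (-(j + 1 : ℤ))) := by
  rw [show (-(j + 1 : ℤ)) = -((j + 1 : ℕ) : ℤ) by push_cast; ring,
    fourierCoeff_circleRestrict_neg_eq_integral (kappaPrime p) (j + 1)]
  simp_rw [kappaPrime_integrand_eq p j, integral_const_mul]
  exact hasSum_residues_rhoPrime_kernel hp j

/-- The same, as the value of the sum. [cite: ConnesConsani2021QuasiInner, §3 (arXiv chunk p0008:L60–L64)] -/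
theorem fourierCoeff_kappaPrime_neg_eq_tsum {p : ℕ} (hp : p.Prime) (j : ℕ) :
    fourierCoeff (T := 1) (circleRestrict 1 (kappaPrime p)) (-(j + 1 : ℤ)) =
      ∑' n : ℤ, 8 * (1 - (p : ℂ)⁻¹) * Real.log p / (4 * π * n + 3 * I * Real.log p) ^ 2 *
        xPrime p n ^ j :=
  (hasSum_fourierCoeff_kappaPrime_neg hp j).tsum_eq.symm

end FourierCoefficients

/-! ### The vectors `U_±(ζ_n)` -/

section Vectors

variable (T : ℝ) [hT : Fact (0 < T)]

/-- The modes `e_{−1}, e_{−2}, …` are orthonormal. [folklore] -/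
private theorem od2_orthonormal_fourierLp_negSucc :
    Orthonormal ℂ fun n : ℕ => fourierLp (T := T) 2 (-(n + 1 : ℤ)) :=
  (orthonormal_fourier (T := T)).comp (fun n : ℕ => -(n + 1 : ℤ)) fun a b h => by
    simpa using h

/-- The non-negative modes `e_0, e_1, …` are orthonormal. [folklore] -/
private theorem od2_orthonormal_fourierLp_natCast :
    Orthonormal ℂ fun n : ℕ => fourierLp (T := T) 2 (n : ℤ) :=
  (orthonormal_fourier (T := T)).comp _ Nat.cast_injective

/-- `U_−(g) = Σ_k g(k) e_{−k−1}` («`U_−(δ_n) = z^{−n−1}`», extended by linearity and continuity).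
[cite: ConnesConsani2021QuasiInner, §3 (arXiv chunk p0008:L129)] -/
theorem hasSum_hardyIsoMinus (g : lp (fun _ : ℕ => ℂ) 2) :
    HasSum (fun k : ℕ => (g k) • fourierLp (T := T) 2 (-(k + 1 : ℤ))) (hardyIsoMinus T g) := by
  have h := (od2_orthonormal_fourierLp_negSucc T).orthogonalFamily.hasSum_linearIsometry g
  simp only [LinearIsometry.toSpanSingleton_apply] at h
  exact h

/-- `U_+(g) = Σ_k g(k) e_k` («`U_+(δ_n) = z^n`», extended by linearity and continuity).
[cite: ConnesConsani2021QuasiInner, §3 (arXiv chunk p0008:L129)] -/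
theorem hasSum_hardyIsoPlus (g : lp (fun _ : ℕ => ℂ) 2) :
    HasSum (fun k : ℕ => (g k) • fourierLp (T := T) 2 (k : ℤ)) (hardyIsoPlus T g) := by
  have h := (od2_orthonormal_fourierLp_natCast T).orthogonalFamily.hasSum_linearIsometry g
  simp only [LinearIsometry.toSpanSingleton_apply] at h
  exact h

/-- `x̄_p(n) = x_p(−n)` («since `\overline{x_p(n)} = x_p(−n)`»).
[cite: ConnesConsani2021QuasiInner, Lemma 3.5, proof (arXiv chunk p0009:L5)] -/
theorem conj_xPrime (p : ℕ) (n : ℤ) : conj (xPrime p n) = xPrime p (-n) := by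
  have h1 : conj (4 * π * n - I * Real.log p : ℂ) = -(4 * π * ((-n : ℤ) : ℂ) - I * Real.log p) := by
    simp only [map_sub, map_mul, map_ofNat, conj_ofReal, conj_I, map_intCast]
    push_cast
    ring
  have h2 : conj (4 * π * n + 3 * I * Real.log p : ℂ) = -(4 * π * ((-n : ℤ) : ℂ) + 3 * I * Real.log p) := by
    simp only [map_add, map_mul, map_ofNat, conj_ofReal, conj_I, map_intCast]
    push_cast
    ring
  rw [xPrime, xPrime, map_div₀, h1, h2, neg_div_neg_eq]

/-- The denominators `4πn + 3i log p` do not vanish (`p > 1`). [folklore] -/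
private theorem od2_den_ne_zero {p : ℕ} (hp : 1 < p) (n : ℤ) :
    (4 * π * n + 3 * I * Real.log p : ℂ) ≠ 0 := by
  have hlog : 0 < Real.log p := Real.log_pos (by exact_mod_cast hp)
  generalize Real.log (p : ℝ) = L at hlog ⊢
  intro h
  have := congrArg Complex.im h
  simp at this
  linarith

/-- **`U_−(ζ_n) = (2^{3/2}(log p)^{1/2}/(4πn + 3i log p)) ξ_{x_p(n)}`** (both sides are
`Σ_k ζ_n(k) e_{−k−1}`, `ξ_x = Σ_k x^k e_{−k−1}`).
[cite: ConnesConsani2021QuasiInner, Lemma 3.5, proof (arXiv chunk p0008:L137–p0009:L2)] -/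
theorem hardyIsoMinus_zetaVec {p : ℕ} (hp : 1 < p) (n : ℤ) :
    hardyIsoMinus T (zetaVec p n) =
      ((Real.sqrt (8 * Real.log p) : ℂ) / (4 * π * n + 3 * I * Real.log p)) • xiVec T (xPrime p n) := by
  have h1 := hasSum_hardyIsoMinus T (zetaVec p n)
  have h2 := (hasSum_xiVec (T := T) (xPrime p n) (norm_xPrime_lt_one hp n)).const_smul
    ((Real.sqrt (8 * Real.log p) : ℂ) / (4 * π * n + 3 * I * Real.log p))
  refine h1.unique ?_
  convert h2 using 1
  funext k
  rw [zetaVec_apply hp n k, zetaCoord, smul_smul]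

/-- **`U_+(ζ_n) = (2^{3/2}(log p)^{1/2}/(4πn + 3i log p)) η_{x_p(−n)}`** — equivalently the printed
`−(2^{3/2}(log p)^{1/2}/(4πn − 3i log p)) η_{x_p(n)} = U_+(ζ_{−n})` (both sides are `Σ_k ζ_n(k) e_k`,
`η_x = Σ_k x̄^k e_k`, `x̄_p(−n) = x_p(n)`).
[cite: ConnesConsani2021QuasiInner, Lemma 3.5, proof (arXiv chunk p0009:L5–L9)] -/
theorem hardyIsoPlus_zetaVec {p : ℕ} (hp : 1 < p) (n : ℤ) :
    hardyIsoPlus T (zetaVec p n) =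
      ((Real.sqrt (8 * Real.log p) : ℂ) / (4 * π * n + 3 * I * Real.log p)) • etaVec T (xPrime p (-n)) := by
  have h1 := hasSum_hardyIsoPlus T (zetaVec p n)
  have hx : ‖xPrime p (-n)‖ < 1 := norm_xPrime_lt_one hp (-n)
  have h2 := (hasSum_etaVec (T := T) (xPrime p (-n)) hx).const_smul
    ((Real.sqrt (8 * Real.log p) : ℂ) / (4 * π * n + 3 * I * Real.log p))
  refine h1.unique ?_
  convert h2 using 1
  funext k
  rw [zetaVec_apply hp n k, zetaCoord, smul_smul, conj_xPrime, neg_neg]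

end Vectors

/-! ### The strong expansion of the bounded model `((1−p)/p) U_− V I V^* U_+^*` -/

section Model

/-- `x = Σ_n x(n) δ_n` in `ℓ²(ℤ)`. [folklore] -/
private theorem od2_hasSum_single_smul (x : lp (fun _ : ℤ => ℂ) 2) :
    HasSum (fun n : ℤ => (x n) • (lp.single 2 n (1 : ℂ) : lp (fun _ : ℤ => ℂ) 2)) x := by
  have h : HasSum (fun n : ℤ => (lp.single 2 n (x n) : lp (fun _ : ℤ => ℂ) 2)) x :=
    lp.hasSum_single ENNReal.ofNat_ne_top x
  have he : (fun n : ℤ => (x n) • (lp.single 2 n (1 : ℂ) : lp (fun _ : ℤ => ℂ) 2)) =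
      fun n => (lp.single 2 n (x n) : lp (fun _ : ℤ => ℂ) 2) := by
    funext n
    rw [← lp.single_smul, smul_eq_mul, mul_one]
  rw [he]
  exact h

/-- The `n`-th coordinate of `x ∈ ℓ²(ℤ)` is `⟨δ_n | x⟩`. [folklore] -/
private theorem od2_apply_eq_inner_single (x : lp (fun _ : ℤ => ℂ) 2) (n : ℤ) :
    x n = ⟪(lp.single 2 n (1 : ℂ) : lp (fun _ : ℤ => ℂ) 2), x⟫_ℂ := by
  classical
  rw [lp.inner_single_left]
  simp

/-- The scalar identity behind display «offdiag2» ⇔ Lemma 3.5: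
`((1−p)/p) · (−(√(8 log p))²) = 8(1 − 1/p) log p`. [cite: ConnesConsani2021QuasiInner, Lemma 3.5, proof (arXiv chunk p0009:L13–L22)] -/
private theorem od2_scalar {p : ℕ} (hp : 1 < p) (n : ℤ) :
    ((((1 - (p : ℝ)) / p : ℝ)) : ℂ) *
        (-((Real.sqrt (8 * Real.log p) : ℂ) / (4 * π * n + 3 * I * Real.log p)) *
          ((Real.sqrt (8 * Real.log p) : ℂ) / (4 * π * n + 3 * I * Real.log p))) =
      8 * (1 - (p : ℂ)⁻¹) * Real.log p / (4 * π * n + 3 * I * Real.log p) ^ 2 := by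
  have hlog : 0 < Real.log p := Real.log_pos (by exact_mod_cast hp)
  have hp0 : (p : ℂ) ≠ 0 := Nat.cast_ne_zero.2 (by omega)
  have hD := od2_den_ne_zero hp n
  have hs : ((Real.sqrt (8 * Real.log p) : ℂ)) ^ 2 = 8 * Real.log p := by
    rw [← ofReal_pow, Real.sq_sqrt (by positivity)]; push_cast; ring
  rw [neg_mul, div_mul_div_comm, ← pow_two, ← pow_two, hs]
  push_cast
  field_simp
  ring

/-- **The strong expansion of the model operator** (the computation proving Lemma 3.5, read from right
to left): for ANY bounded `V : ℓ²(ℤ) → ℓ²(ℕ)` with `Vδ_n = ζ_n` and ANY bounded `I` with `Iδ_n = δ_{−n}`,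
and every `f ∈ L²(S¹)`,
`Σ_{n∈ℤ} 8(1 − 1/p) log p (4πn + 3i log p)^{−2} |ξ_{x_p(n)}⟩⟨η_{x_p(n)}| f = ((1−p)/p) U_− V I V^* U_+^* f`
(unconditional convergence in `L²(S¹)`): expand `V^*U_+^*f = Σ_n w(n)δ_n` in `ℓ²(ℤ)`, push the series
through the bounded `U_− V I`, and use `U_−(ζ_n) = (√(8L)/(4πn+3iL))ξ_{x_p(n)}`,
`w(−n) = ⟨U_+ζ_{−n} | f⟩ = −(√(8L)/(4πn+3iL))⟨η_{x_p(n)} | f⟩`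
(«`(−8 log p/(4πn+3i log p)²)|ξ_{x_p(n)}⟩⟨η_{x_p(n)}| = |U_−(ζ_n)⟩⟨U_+(ζ_{−n})|` …
`U_−VIV^*U_+^* = Σ_ℤ |U_−(V(δ_n))⟩⟨U_+(V(δ_{−n}))|`»).
[cite: ConnesConsani2021QuasiInner, Lemma 3.5, proof (arXiv chunk p0008:L137–p0009:L32)] -/
theorem hasSum_rankOne_primeModel {p : ℕ} (hp : p.Prime)
    (V : lp (fun _ : ℤ => ℂ) 2 →L[ℂ] lp (fun _ : ℕ => ℂ) 2)
    (Iop : lp (fun _ : ℤ => ℂ) 2 →L[ℂ] lp (fun _ : ℤ => ℂ) 2)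
    (hV : ∀ n : ℤ, V (lp.single 2 n (1 : ℂ)) = zetaVec p n)
    (hI : ∀ n : ℤ, Iop (lp.single 2 n (1 : ℂ)) = lp.single 2 (-n) (1 : ℂ))
    (f : Lp ℂ 2 (haarAddCircle (T := 1))) :
    HasSum
      (fun n : ℤ => (((8 * (1 - (p : ℂ)⁻¹) * Real.log p) / (4 * π * n + 3 * I * Real.log p) ^ 2) •
        InnerProductSpace.rankOne ℂ (xiVec 1 (xPrime p n)) (etaVec 1 (xPrime p n))) f)
      ((((((1 - (p : ℝ)) / p : ℝ)) : ℂ) •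
          ((hardyIsoMinus 1).toContinuousLinearMap ∘L V ∘L Iop ∘L (ContinuousLinearMap.adjoint V) ∘L
            ContinuousLinearMap.adjoint (hardyIsoPlus 1).toContinuousLinearMap)) f) := by
  have hp1 : 1 < p := hp.one_lt
  -- normal form of the summands and of the value
  simp only [FunLike.coe_smul, Pi.smul_apply, ContinuousLinearMap.comp_apply,
    InnerProductSpace.rankOne_apply, smul_smul]
  set Um : lp (fun _ : ℕ => ℂ) 2 →L[ℂ] Lp ℂ 2 (haarAddCircle (T := 1)) :=
    (hardyIsoMinus 1).toContinuousLinearMap with hUm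
  set Up : lp (fun _ : ℕ => ℂ) 2 →L[ℂ] Lp ℂ 2 (haarAddCircle (T := 1)) :=
    (hardyIsoPlus 1).toContinuousLinearMap with hUp
  set c : ℂ := ((((1 - (p : ℝ)) / p : ℝ)) : ℂ) with hc
  set w : lp (fun _ : ℤ => ℂ) 2 :=
    ContinuousLinearMap.adjoint V (ContinuousLinearMap.adjoint Up f) with hw
  -- push `w = Σ w(n) δ_n` through the bounded operator `c • U_− V I`
  have h1 := (c • (Um ∘L V ∘L Iop)).hasSum (od2_hasSum_single_smul w)
  simp only [map_smul, FunLike.coe_smul, Pi.smul_apply, ContinuousLinearMap.comp_apply, hI, hV,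
    smul_smul] at h1
  -- `h1 : HasSum (fun n => (c * w n) • Um (ζ_{−n})) (c • Um (V (Iop w)))`; reindex `n ↦ −n`
  have h3 : HasSum (fun n : ℤ => (c * w (-n)) • Um (zetaVec p n)) (c • Um (V (Iop w))) := by
    rw [← (Equiv.neg ℤ).hasSum_iff]
    have e2 : (fun n : ℤ => (c * w (-n)) • Um (zetaVec p n)) ∘ (Equiv.neg ℤ) =
        fun n : ℤ => (w n * c) • Um (zetaVec p (-n)) := by
      funext n
      simp only [Function.comp_apply, Equiv.neg_apply, neg_neg, mul_comm]
    rw [e2]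
    exact h1
  -- the terms
  have e3 : (fun n : ℤ => (8 * (1 - (p : ℂ)⁻¹) * Real.log p / (4 * π * n + 3 * I * Real.log p) ^ 2 *
        ⟪etaVec 1 (xPrime p n), f⟫_ℂ) • xiVec 1 (xPrime p n)) =
      fun n : ℤ => (c * w (-n)) • Um (zetaVec p n) := by
    funext n
    have hwn : w (-n) = -((Real.sqrt (8 * Real.log p) : ℂ) / (4 * π * n + 3 * I * Real.log p)) *
        ⟪etaVec 1 (xPrime p n), f⟫_ℂ := by
      rw [od2_apply_eq_inner_single, hw, ContinuousLinearMap.adjoint_inner_right,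
        ContinuousLinearMap.adjoint_inner_right, hV, hUp, LinearIsometry.coe_toContinuousLinearMap,
        hardyIsoPlus_zetaVec 1 hp1 (-n), neg_neg, inner_smul_left]
      congr 1
      rw [map_div₀, conj_ofReal]
      have : conj (4 * π * ((-n : ℤ) : ℂ) + 3 * I * Real.log p : ℂ) =
          -(4 * π * n + 3 * I * Real.log p) := by
        simp only [map_add, map_mul, map_ofNat, conj_ofReal, conj_I, map_intCast]
        push_cast
        ring
      rw [this, div_neg]
    have hUmζ : Um (zetaVec p n) = ((Real.sqrt (8 * Real.log p) : ℂ) /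
        (4 * π * n + 3 * I * Real.log p)) • xiVec 1 (xPrime p n) := by
      rw [hUm, LinearIsometry.coe_toContinuousLinearMap]
      exact hardyIsoMinus_zetaVec 1 hp1 n
    rw [hwn, hUmζ, smul_smul, ← od2_scalar hp1 n]
    congr 1
    ring
  rw [e3]
  exact h3

end Model

/-! ### The matrix of `(1 − 𝒫)u𝒫` in the Fourier basis -/

section Matrix

variable (T : ℝ) [hT : Fact (0 < T)]

/-- **`⟨e_{−k−1} | (1 − 𝒫)u𝒫 e_b⟩ = û(−k−b−1)`** for `b ≥ 0` and any `u ∈ L^∞(S¹)`: `𝒫e_b = e_b`,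
`(1 − 𝒫)` is the self-adjoint projection fixing `e_{−k−1}`, and `⟨e_{−k−1} | u e_b⟩ = ∫ u e_{k+b+1}`.
(The computation by which «the negative part of the Fourier expansion of `κ`» determines
`(1 − 𝒫)κ𝒫`, p0006:L59–L68 / p0008:L66–L69.)
[cite: ConnesConsani2021QuasiInner, §2 Thm 2.3 proof (arXiv chunk p0006:L59–L68) and §3 (p0008:L66–L69)] -/
theorem inner_fourierLp_negSucc_hardyOffDiag_fourierLp_natCast
    (u : Lp ℂ ∞ (haarAddCircle (T := T))) (k b : ℕ) :
    ⟪fourierLp (T := T) 2 (-(k + 1 : ℤ)), hardyOffDiag T u (fourierLp (T := T) 2 (b : ℤ))⟫_ℂ =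
      fourierCoeff (T := T) (u : AddCircle T → ℂ) (-((k + b : ℕ) + 1 : ℤ)) := by
  have happ : hardyOffDiag T u (fourierLp (T := T) 2 (b : ℤ)) =
      mulOp haarAddCircle u (fourierLp (T := T) 2 (b : ℤ)) -
        hardyProjection T (mulOp haarAddCircle u (fourierLp (T := T) 2 (b : ℤ))) := by
    simp only [hardyOffDiag, offDiag, mul_apply_eq_comp, sub_apply, one_apply_eq_self,
      hardyProjection_fourierLp_natCast]
  have hP : ⟪fourierLp (T := T) 2 (-(k + 1 : ℤ)),
      hardyProjection T (mulOp haarAddCircle u (fourierLp (T := T) 2 (b : ℤ)))⟫_ℂ = 0 := by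
    have h0 : (hardySpace T).starProjection (fourierLp (T := T) 2 (-(k + 1 : ℤ))) = 0 :=
      hardyProjection_fourierLp_negSucc k
    rw [hardyProjection, ← Submodule.inner_starProjection_left_eq_right, h0, inner_zero_left]
  rw [happ, inner_sub_right, hP, sub_zero]
  simp only [fourierCoeff, smul_eq_mul]
  rw [MeasureTheory.L2.inner_def]
  refine integral_congr_ae ?_
  filter_upwards [coeFn_mulOp haarAddCircle u (fourierLp (T := T) 2 (b : ℤ)),
    coeFn_fourierLp (T := T) 2 (b : ℤ), coeFn_fourierLp (T := T) 2 (-(k + 1 : ℤ))]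
    with t h1 h2 h3
  rw [h1, h3, h2, RCLike.inner_apply', ← fourier_neg, neg_neg, neg_neg,
    show ((k + b : ℕ) : ℤ) + 1 = (k + 1 : ℤ) + b by push_cast; ring]
  simp only [fourier_add]
  ring

/-- `⟨e_a | (1 − 𝒫)u𝒫 v⟩ = 0` for `a ≥ 0` (the range of `1 − 𝒫` is `(H²)^⊥`).
[cite: ConnesConsani2021QuasiInner, Introduction, Definition (arXiv chunk p0003:L5)] -/
theorem inner_fourierLp_natCast_hardyOffDiag (u : Lp ℂ ∞ (haarAddCircle (T := T))) (a : ℕ)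
    (v : Lp ℂ 2 (haarAddCircle (T := T))) :
    ⟪fourierLp (T := T) 2 (a : ℤ), hardyOffDiag T u v⟫_ℂ = 0 := by
  have happ : hardyOffDiag T u v =
      mulOp haarAddCircle u (hardyProjection T v) -
        hardyProjection T (mulOp haarAddCircle u (hardyProjection T v)) := by
    simp only [hardyOffDiag, offDiag, mul_apply_eq_comp, sub_apply, one_apply_eq_self]
  have ha : (hardySpace T).starProjection (fourierLp (T := T) 2 (a : ℤ)) = fourierLp (T := T) 2 (a : ℤ) :=
    hardyProjection_fourierLp_natCast a
  rw [happ, inner_sub_right, hardyProjection, ← Submodule.inner_starProjection_left_eq_right, ha,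
    sub_self]

/-- `(1 − 𝒫)u𝒫 e_{−m−1} = 0` (`𝒫e_{−m−1} = 0`).
[cite: ConnesConsani2021QuasiInner, Introduction, Definition (arXiv chunk p0003:L5)] -/
theorem hardyOffDiag_fourierLp_negSucc (u : Lp ℂ ∞ (haarAddCircle (T := T))) (m : ℕ) :
    hardyOffDiag T u (fourierLp (T := T) 2 (-(m + 1 : ℤ))) = 0 := by
  simp only [hardyOffDiag, offDiag, mul_apply_eq_comp, hardyProjection_fourierLp_negSucc, map_zero]

/-- Two vectors of `L²(S¹)` with the same Fourier coefficients are equal. [folklore] -/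
private theorem od2_eq_of_inner_fourierLp_eq {v w : Lp ℂ 2 (haarAddCircle (T := T))}
    (h : ∀ n : ℤ, ⟪fourierLp (T := T) 2 n, v⟫_ℂ = ⟪fourierLp (T := T) 2 n, w⟫_ℂ) : v = w := by
  apply (fourierBasis (T := T)).repr.injective
  ext n
  have e : ∀ u : Lp ℂ 2 (haarAddCircle (T := T)),
      (fourierBasis (T := T)).repr u n = ⟪fourierLp (T := T) 2 n, u⟫_ℂ := fun u => by
    rw [HilbertBasis.repr_apply_apply, coe_fourierBasis]
  rw [e, e, h n]

/-- Fourier coefficients only depend on the a.e. class. [folklore] -/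
private theorem od2_fourierCoeff_congr_ae {f g : AddCircle T → ℂ}
    (h : f =ᵐ[haarAddCircle (T := T)] g) (n : ℤ) :
    fourierCoeff (T := T) f n = fourierCoeff (T := T) g n := by
  simp only [fourierCoeff]
  exact integral_congr_ae (by filter_upwards [h] with x hx; simp only [hx])

end Matrix

/-! ### Lemma 3.5 and display «offdiag2» -/

section LemmaThreeFive

/-- The summands of display «offdiag2» paired with two Fourier modes:
`⟨e_a | c_n |ξ_{x_n}⟩⟨η_{x_n}| e_b⟩ = c_n ⟨η_{x_n} | e_b⟩ ⟨e_a | ξ_{x_n}⟩`. [folklore] -/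
private theorem od2_inner_term (p : ℕ) (n a b : ℤ) :
    ⟪fourierLp (T := 1) 2 a,
      (((8 * (1 - (p : ℂ)⁻¹) * Real.log p) / (4 * π * n + 3 * I * Real.log p) ^ 2) •
        InnerProductSpace.rankOne ℂ (xiVec 1 (xPrime p n)) (etaVec 1 (xPrime p n)))
        (fourierLp (T := 1) 2 b)⟫_ℂ =
      8 * (1 - (p : ℂ)⁻¹) * Real.log p / (4 * π * n + 3 * I * Real.log p) ^ 2 *
        (⟪etaVec 1 (xPrime p n), fourierLp (T := 1) 2 b⟫_ℂ *
          ⟪fourierLp (T := 1) 2 a, xiVec 1 (xPrime p n)⟫_ℂ) := by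
  rw [FunLike.coe_smul, Pi.smul_apply, InnerProductSpace.rankOne_apply, inner_smul_right,
    inner_smul_right]

/-- **The matrix of the model** in the Fourier basis, entries `(−k−1, b)`, `b ≥ 0`:
`⟨e_{−k−1} | ((1−p)/p)U_−VIV^*U_+^* e_b⟩ = Σ_n c_n x_p(n)^{k+b} = κ̂_p(−k−b−1)` (strong expansion
`hasSum_rankOne_primeModel`, `⟨e_{−k−1}|ξ_x⟩ = x^k`, `⟨η_x|e_b⟩ = x^b`, and
`hasSum_fourierCoeff_kappaPrime_neg`).
[cite: ConnesConsani2021QuasiInner, §3 (arXiv chunk p0008:L60–L75) with Lemma 3.5, proof (p0009:L13–L30)] -/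
theorem inner_fourierLp_negSucc_primeModel_fourierLp_natCast {p : ℕ} (hp : p.Prime)
    (V : lp (fun _ : ℤ => ℂ) 2 →L[ℂ] lp (fun _ : ℕ => ℂ) 2)
    (Iop : lp (fun _ : ℤ => ℂ) 2 →L[ℂ] lp (fun _ : ℤ => ℂ) 2)
    (hV : ∀ n : ℤ, V (lp.single 2 n (1 : ℂ)) = zetaVec p n)
    (hI : ∀ n : ℤ, Iop (lp.single 2 n (1 : ℂ)) = lp.single 2 (-n) (1 : ℂ)) (k b : ℕ) :
    ⟪fourierLp (T := 1) 2 (-(k + 1 : ℤ)),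
      ((((((1 - (p : ℝ)) / p : ℝ)) : ℂ) •
          ((hardyIsoMinus 1).toContinuousLinearMap ∘L V ∘L Iop ∘L (ContinuousLinearMap.adjoint V) ∘L
            ContinuousLinearMap.adjoint (hardyIsoPlus 1).toContinuousLinearMap))
        (fourierLp (T := 1) 2 (b : ℤ)))⟫_ℂ =
      fourierCoeff (T := 1) (circleRestrict 1 (kappaPrime p)) (-((k + b : ℕ) + 1 : ℤ)) := by
  have hp1 : 1 < p := hp.one_lt
  have h := (innerSL ℂ (fourierLp (T := 1) 2 (-(k + 1 : ℤ)))).hasSum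
    (hasSum_rankOne_primeModel hp V Iop hV hI (fourierLp (T := 1) 2 (b : ℤ)))
  simp only [innerSL_apply_apply] at h
  have hterm : (fun n : ℤ => ⟪fourierLp (T := 1) 2 (-(k + 1 : ℤ)),
      (((8 * (1 - (p : ℂ)⁻¹) * Real.log p) / (4 * π * n + 3 * I * Real.log p) ^ 2) •
        InnerProductSpace.rankOne ℂ (xiVec 1 (xPrime p n)) (etaVec 1 (xPrime p n)))
        (fourierLp (T := 1) 2 (b : ℤ))⟫_ℂ) =
      fun n : ℤ => 8 * (1 - (p : ℂ)⁻¹) * Real.log p / (4 * π * n + 3 * I * Real.log p) ^ 2 *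
        xPrime p n ^ (k + b) := by
    funext n
    have hx : ‖xPrime p n‖ < 1 := norm_xPrime_lt_one hp1 n
    rw [od2_inner_term, inner_fourierLp_negSucc_xiVec 1 _ hx k, ← inner_conj_symm,
      inner_fourierLp_natCast_etaVec _ hx b, map_pow, Complex.conj_conj, pow_add, mul_comm (xPrime p n ^ b)]
  rw [hterm] at h
  exact h.unique (hasSum_fourierCoeff_kappaPrime_neg hp (k + b))

/-- The model has no matrix entries in non-negative rows: `⟨e_a | model v⟩ = 0` for `a ≥ 0`
(`⟨e_a|ξ_x⟩ = 0`). [cite: ConnesConsani2021QuasiInner, Lemma 2.2, proof (arXiv chunk p0006:L30–L41)] -/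
theorem inner_fourierLp_natCast_primeModel {p : ℕ} (hp : p.Prime)
    (V : lp (fun _ : ℤ => ℂ) 2 →L[ℂ] lp (fun _ : ℕ => ℂ) 2)
    (Iop : lp (fun _ : ℤ => ℂ) 2 →L[ℂ] lp (fun _ : ℤ => ℂ) 2)
    (hV : ∀ n : ℤ, V (lp.single 2 n (1 : ℂ)) = zetaVec p n)
    (hI : ∀ n : ℤ, Iop (lp.single 2 n (1 : ℂ)) = lp.single 2 (-n) (1 : ℂ)) (a : ℕ) (b : ℤ) :
    ⟪fourierLp (T := 1) 2 (a : ℤ),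
      ((((((1 - (p : ℝ)) / p : ℝ)) : ℂ) •
          ((hardyIsoMinus 1).toContinuousLinearMap ∘L V ∘L Iop ∘L (ContinuousLinearMap.adjoint V) ∘L
            ContinuousLinearMap.adjoint (hardyIsoPlus 1).toContinuousLinearMap))
        (fourierLp (T := 1) 2 b))⟫_ℂ = 0 := by
  have hp1 : 1 < p := hp.one_lt
  have h := (innerSL ℂ (fourierLp (T := 1) 2 (a : ℤ))).hasSum
    (hasSum_rankOne_primeModel hp V Iop hV hI (fourierLp (T := 1) 2 b))
  simp only [innerSL_apply_apply] at h
  have hterm : (fun n : ℤ => ⟪fourierLp (T := 1) 2 (a : ℤ),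
      (((8 * (1 - (p : ℂ)⁻¹) * Real.log p) / (4 * π * n + 3 * I * Real.log p) ^ 2) •
        InnerProductSpace.rankOne ℂ (xiVec 1 (xPrime p n)) (etaVec 1 (xPrime p n)))
        (fourierLp (T := 1) 2 b)⟫_ℂ) = fun _ : ℤ => 0 := by
    funext n
    have hx : ‖xPrime p n‖ < 1 := norm_xPrime_lt_one hp1 n
    rw [od2_inner_term, inner_fourierLp_natCast_xiVec 1 _ hx a, mul_zero, mul_zero]
  rw [hterm] at h
  exact h.unique hasSum_zero

/-- The model kills the negative modes: `model e_{−m−1} = 0` (`⟨η_x|e_{−m−1}⟩ = 0`).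
[cite: ConnesConsani2021QuasiInner, Lemma 2.2, proof (arXiv chunk p0006:L41)] -/
theorem primeModel_fourierLp_negSucc {p : ℕ} (hp : p.Prime)
    (V : lp (fun _ : ℤ => ℂ) 2 →L[ℂ] lp (fun _ : ℕ => ℂ) 2)
    (Iop : lp (fun _ : ℤ => ℂ) 2 →L[ℂ] lp (fun _ : ℤ => ℂ) 2)
    (hV : ∀ n : ℤ, V (lp.single 2 n (1 : ℂ)) = zetaVec p n)
    (hI : ∀ n : ℤ, Iop (lp.single 2 n (1 : ℂ)) = lp.single 2 (-n) (1 : ℂ)) (m : ℕ) :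
    ((((((1 - (p : ℝ)) / p : ℝ)) : ℂ) •
          ((hardyIsoMinus 1).toContinuousLinearMap ∘L V ∘L Iop ∘L (ContinuousLinearMap.adjoint V) ∘L
            ContinuousLinearMap.adjoint (hardyIsoPlus 1).toContinuousLinearMap))
        (fourierLp (T := 1) 2 (-(m + 1 : ℤ)))) = 0 := by
  have hp1 : 1 < p := hp.one_lt
  have h := hasSum_rankOne_primeModel hp V Iop hV hI (fourierLp (T := 1) 2 (-(m + 1 : ℤ)))
  have hterm : (fun n : ℤ =>
      ((((8 * (1 - (p : ℂ)⁻¹) * Real.log p) / (4 * π * n + 3 * I * Real.log p) ^ 2) •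
        InnerProductSpace.rankOne ℂ (xiVec 1 (xPrime p n)) (etaVec 1 (xPrime p n)))
        (fourierLp (T := 1) 2 (-(m + 1 : ℤ))))) = fun _ : ℤ => 0 := by
    funext n
    have hx : ‖xPrime p n‖ < 1 := norm_xPrime_lt_one hp1 n
    rw [FunLike.coe_smul, Pi.smul_apply, InnerProductSpace.rankOne_apply, ← inner_conj_symm,
      inner_fourierLp_negSucc_etaVec _ hx m, map_zero, zero_smul, smul_zero]
  rw [hterm] at h
  exact h.unique hasSum_zero

/-- **Lemma 3.5 PROVED** («`(1 − 𝒫)κ_p𝒫 = ((1−p)/p) U_− V I V^* U_+^*`», first equality of display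
«offdiag2bis», for ANY bounded `V` with `Vδ_n = ζ_n` and ANY bounded `I` with `Iδ_n = δ_{−n}`): both
sides are bounded operators with the same matrix in the Fourier basis — rows `a ≥ 0` and columns
`b < 0` vanish on both sides, and the entry `(−k−1, b)`, `b ≥ 0`, is `κ̂_p(−k−b−1)` on the left
(`inner_fourierLp_negSucc_hardyOffDiag_fourierLp_natCast`) and `Σ_n c_n x_p(n)^{k+b} = κ̂_p(−k−b−1)`
on the right (the printed proof, p0008:L137–p0009:L32, run through the Fourier coefficients
«aminusk»-style, p0008:L21–L75). Discharges the named fact `lemma_3_5`.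
[cite: ConnesConsani2021QuasiInner, Lemma 3.5 «offdiag2bis» (arXiv chunk p0008:L131–L135; proof p0008:L137–p0009:L32)] -/
theorem lemma_3_5_holds : lemma_3_5 := by
  intro p hp V Iop hV hI
  have hp1 : 1 < p := hp.one_lt
  -- the two operators agree on every Fourier mode
  have hdense : Dense (Submodule.span ℂ (Set.range (fourierLp (T := 1) 2)) :
      Set (Lp ℂ 2 (haarAddCircle (T := 1)))) :=
    Submodule.dense_iff_topologicalClosure_eq_top.2 (span_fourierLp_closure_eq_top (by norm_num))
  refine ContinuousLinearMap.ext_on hdense ?_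
  rintro _ ⟨m, rfl⟩
  -- the a.e. class of `κ_p|S¹`
  obtain ⟨hmem, -, hu⟩ := memLp_circleRestrict_kappaPrime hp1
  have hae : ((toLpOrZero ∞ haarAddCircle (circleRestrict 1 (kappaPrime p)) :
      Lp ℂ ∞ (haarAddCircle (T := 1))) : AddCircle (1:ℝ) → ℂ) =ᵐ[haarAddCircle (T := 1)]
      circleRestrict 1 (kappaPrime p) := by
    rw [hu]
    exact MemLp.coeFn_toLp _
  rcases m with b | m
  · -- column `b ≥ 0`: compare all Fourier coefficients
    rw [Int.ofNat_eq_natCast]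
    refine od2_eq_of_inner_fourierLp_eq 1 fun a => ?_
    rcases a with a | k
    · rw [Int.ofNat_eq_natCast, inner_fourierLp_natCast_hardyOffDiag,
        inner_fourierLp_natCast_primeModel hp V Iop hV hI]
    · rw [Int.negSucc_eq, inner_fourierLp_negSucc_hardyOffDiag_fourierLp_natCast,
        inner_fourierLp_negSucc_primeModel_fourierLp_natCast hp V Iop hV hI,
        od2_fourierCoeff_congr_ae 1 hae]
  · -- column `−m−1`: both sides vanish
    rw [Int.negSucc_eq, hardyOffDiag_fourierLp_negSucc, primeModel_fourierLp_negSucc hp V Iop hV hI]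

/-- The flipped unit vectors `δ_{−n} ∈ ℓ²(ℤ)` form an orthonormal family. [folklore] -/
private theorem od2_orthonormal_single_neg :
    Orthonormal ℂ (fun n : ℤ => (lp.single 2 (-n) (1 : ℂ) : lp (fun _ : ℤ => ℂ) 2)) := by
  classical
  rw [orthonormal_iff_ite]
  intro m n
  rw [lp.inner_single_left, lp.single_apply]
  by_cases h : m = n
  · subst h; simp
  · simp [h]

/-- **Display «offdiag2» PROVED**: for every prime `p` and every `f ∈ L²(S¹)`,
`(1 − 𝒫)κ_p𝒫 f = Σ_{n∈ℤ} 8(1 − 1/p) log p (4πn + 3i log p)^{−2} |ξ_{x_p(n)}⟩⟨η_{x_p(n)}| f`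
(unconditionally convergent in `L²(S¹)`) — Lemma 3.5 (with `V` from Lemma 3.4 = `lemma_3_4_holds` and
`I` the flip isometry of `ℓ²(ℤ)`) and the strong expansion of the model `hasSum_rankOne_primeModel`.
Discharges the named fact `display_offdiag2`.
[cite: ConnesConsani2021QuasiInner, §3 display «offdiag2» (arXiv chunk p0008:L21–L75) with Lemma 3.5 (p0008:L131–p0009:L32)] -/
theorem display_offdiag2_holds : display_offdiag2 := by
  intro p hp f
  classical
  obtain ⟨V, U, hV, -, -, -⟩ :=
    lemma_3_4_holds p hp (lemma33Model p hp.one_lt) (isLemma33Operator_lemma33Model hp)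
  set Iop : lp (fun _ : ℤ => ℂ) 2 →L[ℂ] lp (fun _ : ℤ => ℂ) 2 :=
    od2_orthonormal_single_neg.orthogonalFamily.linearIsometry.toContinuousLinearMap with hIop
  have hI : ∀ n : ℤ, Iop (lp.single 2 n (1 : ℂ)) = lp.single 2 (-n) (1 : ℂ) := by
    intro n
    rw [hIop, LinearIsometry.coe_toContinuousLinearMap, OrthogonalFamily.linearIsometry_apply_single]
    simp
  rw [lemma_3_5_holds p hp V Iop hV hI]
  exact hasSum_rankOne_primeModel hp V Iop hV hI f

/-- **Fact 3.6 PROVED** («The function `ρ_p` is not quasi-inner»: `κ_p|_{S¹} ∈ L^∞` unimodular and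
`(1 − 𝒫)κ_p𝒫` NOT compact, «same strength as `BIB`») — seat t17's landed reduction
`fact_3_6_of_lemma_3_5` applied to `lemma_3_5_holds`. Discharges the named fact `fact_3_6`.
[cite: ConnesConsani2021QuasiInner, Fact 3.6 «factnq» (arXiv chunk p0009:L32–L36)] -/
theorem fact_3_6_holds : fact_3_6 := fact_3_6_of_lemma_3_5 lemma_3_5_holds

end LemmaThreeFive

/-! ### The model with a diagonal factor: `((1−p)/p) U_− V D I V^* U_+^*` (Theorem 4.4 (ii), `ℰ_p`) -/

section ModelDiag

/-- **Strong expansion of the model with a diagonal factor** (the term `ℰ_p = ((1−p)/p)U_−VDIV^*U_+^*`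
of Theorem 4.4 (ii): «`DI = Σ_{ℤ∖{0}} ρ_∞(2πin/log p)|δ_n⟩⟨δ_{−n}|`,
`U_−VDIV^*U_+^* = Σ_{ℤ∖{0}} ρ_∞(2πin/log p)|U_−(V(δ_n))⟩⟨U_+(V(δ_{−n}))|` as in Lemma 3.5»): for ANY
bounded `V` with `Vδ_n = ζ_n`, ANY bounded `I` with `Iδ_n = δ_{−n}`, ANY bounded diagonal `D` with
`Dδ_n = d_nδ_n`, and every `f ∈ L²(S¹)`,
`Σ_{n∈ℤ} d_n·8(1 − 1/p)log p(4πn + 3i log p)^{−2}|ξ_{x_p(n)}⟩⟨η_{x_p(n)}| f = ((1−p)/p)U_−VDIV^*U_+^* f`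
(unconditional convergence in `L²(S¹)`; same proof as `hasSum_rankOne_primeModel`).
[cite: ConnesConsani2021QuasiInner, Thm 4.4 (ii) proof, display «uinftypoff2» (arXiv chunk p0012:L3–L10)] -/
theorem hasSum_rankOne_primeModel_diag {p : ℕ} (hp : p.Prime)
    (V : lp (fun _ : ℤ => ℂ) 2 →L[ℂ] lp (fun _ : ℕ => ℂ) 2)
    (Iop Dop : lp (fun _ : ℤ => ℂ) 2 →L[ℂ] lp (fun _ : ℤ => ℂ) 2) (d : ℤ → ℂ)
    (hV : ∀ n : ℤ, V (lp.single 2 n (1 : ℂ)) = zetaVec p n)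
    (hI : ∀ n : ℤ, Iop (lp.single 2 n (1 : ℂ)) = lp.single 2 (-n) (1 : ℂ))
    (hD : ∀ n : ℤ, Dop (lp.single 2 n (1 : ℂ)) = d n • lp.single 2 n (1 : ℂ))
    (f : Lp ℂ 2 (haarAddCircle (T := 1))) :
    HasSum
      (fun n : ℤ => ((d n * ((8 * (1 - (p : ℂ)⁻¹) * Real.log p) /
          (4 * π * n + 3 * I * Real.log p) ^ 2)) •
        InnerProductSpace.rankOne ℂ (xiVec 1 (xPrime p n)) (etaVec 1 (xPrime p n))) f)
      ((((((1 - (p : ℝ)) / p : ℝ)) : ℂ) •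
          ((hardyIsoMinus 1).toContinuousLinearMap ∘L V ∘L Dop ∘L Iop ∘L
            (ContinuousLinearMap.adjoint V) ∘L
            ContinuousLinearMap.adjoint (hardyIsoPlus 1).toContinuousLinearMap)) f) := by
  have hp1 : 1 < p := hp.one_lt
  simp only [FunLike.coe_smul, Pi.smul_apply, ContinuousLinearMap.comp_apply,
    InnerProductSpace.rankOne_apply, smul_smul]
  set Um : lp (fun _ : ℕ => ℂ) 2 →L[ℂ] Lp ℂ 2 (haarAddCircle (T := 1)) :=
    (hardyIsoMinus 1).toContinuousLinearMap with hUm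
  set Up : lp (fun _ : ℕ => ℂ) 2 →L[ℂ] Lp ℂ 2 (haarAddCircle (T := 1)) :=
    (hardyIsoPlus 1).toContinuousLinearMap with hUp
  set c : ℂ := ((((1 - (p : ℝ)) / p : ℝ)) : ℂ) with hc
  set w : lp (fun _ : ℤ => ℂ) 2 :=
    ContinuousLinearMap.adjoint V (ContinuousLinearMap.adjoint Up f) with hw
  have h1 := (c • (Um ∘L V ∘L Dop ∘L Iop)).hasSum (od2_hasSum_single_smul w)
  simp only [map_smul, FunLike.coe_smul, Pi.smul_apply, ContinuousLinearMap.comp_apply, hI, hD, hV,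
    smul_smul] at h1
  have h3 : HasSum (fun n : ℤ => (c * w (-n) * d n) • Um (zetaVec p n)) (c • Um (V (Dop (Iop w)))) := by
    rw [← (Equiv.neg ℤ).hasSum_iff]
    convert h1 using 1
    funext n
    simp only [Function.comp_apply, Equiv.neg_apply, neg_neg]
    congr 1
    ring
  have e3 : (fun n : ℤ => (d n * (8 * (1 - (p : ℂ)⁻¹) * Real.log p /
        (4 * π * n + 3 * I * Real.log p) ^ 2) * ⟪etaVec 1 (xPrime p n), f⟫_ℂ) • xiVec 1 (xPrime p n)) =
      fun n : ℤ => (c * w (-n) * d n) • Um (zetaVec p n) := by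
    funext n
    have hwn : w (-n) = -((Real.sqrt (8 * Real.log p) : ℂ) / (4 * π * n + 3 * I * Real.log p)) *
        ⟪etaVec 1 (xPrime p n), f⟫_ℂ := by
      rw [od2_apply_eq_inner_single, hw, ContinuousLinearMap.adjoint_inner_right,
        ContinuousLinearMap.adjoint_inner_right, hV, hUp, LinearIsometry.coe_toContinuousLinearMap,
        hardyIsoPlus_zetaVec 1 hp1 (-n), neg_neg, inner_smul_left]
      congr 1
      rw [map_div₀, conj_ofReal]
      have : conj (4 * π * ((-n : ℤ) : ℂ) + 3 * I * Real.log p : ℂ) =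
          -(4 * π * n + 3 * I * Real.log p) := by
        simp only [map_add, map_mul, map_ofNat, conj_ofReal, conj_I, map_intCast]
        push_cast
        ring
      rw [this, div_neg]
    have hUmζ : Um (zetaVec p n) = ((Real.sqrt (8 * Real.log p) : ℂ) /
        (4 * π * n + 3 * I * Real.log p)) • xiVec 1 (xPrime p n) := by
      rw [hUm, LinearIsometry.coe_toContinuousLinearMap]
      exact hardyIsoMinus_zetaVec 1 hp1 n
    rw [hwn, hUmζ, smul_smul, ← od2_scalar hp1 n]
    congr 1
    ring
  rw [e3]
  exact h3

/-- The diagonal of Theorem 4.4 (ii): `Dδ_0 = 0`, `Dδ_n = ρ_∞(2πin/log p)δ_n` (`n ≠ 0`), as ONE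
formula `Dδ_n = d_nδ_n` with `d_n = [n ≠ 0]·ρ_∞(2πin/log p)`.
[cite: ConnesConsani2021QuasiInner, Thm 4.4 (ii) eq. (4.4) (arXiv chunk p0011:L96–L98)] -/
theorem primeDiag_single_eq {p : ℕ} (Dop : lp (fun _ : ℤ => ℂ) 2 →L[ℂ] lp (fun _ : ℤ => ℂ) 2)
    (hD0 : Dop (lp.single 2 0 (1 : ℂ)) = 0)
    (hD : ∀ n : ℤ, n ≠ 0 →
      Dop (lp.single 2 n (1 : ℂ)) = rhoArch (2 * π * I * n / Real.log p) • lp.single 2 n (1 : ℂ))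
    (n : ℤ) :
    Dop (lp.single 2 n (1 : ℂ)) =
      (if n = 0 then (0 : ℂ) else rhoArch (2 * π * I * n / Real.log p)) • lp.single 2 n (1 : ℂ) := by
  by_cases hn : n = 0
  · subst hn; rw [hD0]; simp
  · rw [hD n hn, if_neg hn]

/-- **The strong expansion of `ℰ_p = ((1−p)/p)U_−VDIV^*U_+^*`** with the printed diagonal
(`Dδ_0 = 0`, `Dδ_n = ρ_∞(2πin/log p)δ_n`):
`ℰ_p f = Σ_{n≠0} ρ_∞(2πin/log p)·8(1−1/p)log p(4πn+3i log p)^{−2}|ξ_{x_p(n)}⟩⟨η_{x_p(n)}| f`.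
[cite: ConnesConsani2021QuasiInner, Thm 4.4 (ii) proof, displays «uinftypoff2» (arXiv chunk p0012:L3–L10)] -/
theorem hasSum_rankOne_primeModel_rhoArchDiag {p : ℕ} (hp : p.Prime)
    (V : lp (fun _ : ℤ => ℂ) 2 →L[ℂ] lp (fun _ : ℕ => ℂ) 2)
    (Iop Dop : lp (fun _ : ℤ => ℂ) 2 →L[ℂ] lp (fun _ : ℤ => ℂ) 2)
    (hV : ∀ n : ℤ, V (lp.single 2 n (1 : ℂ)) = zetaVec p n)
    (hI : ∀ n : ℤ, Iop (lp.single 2 n (1 : ℂ)) = lp.single 2 (-n) (1 : ℂ))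
    (hD0 : Dop (lp.single 2 0 (1 : ℂ)) = 0)
    (hD : ∀ n : ℤ, n ≠ 0 →
      Dop (lp.single 2 n (1 : ℂ)) = rhoArch (2 * π * I * n / Real.log p) • lp.single 2 n (1 : ℂ))
    (f : Lp ℂ 2 (haarAddCircle (T := 1))) :
    HasSum
      (fun n : ℤ => (((if n = 0 then (0 : ℂ) else rhoArch (2 * π * I * n / Real.log p)) *
          ((8 * (1 - (p : ℂ)⁻¹) * Real.log p) / (4 * π * n + 3 * I * Real.log p) ^ 2)) •
        InnerProductSpace.rankOne ℂ (xiVec 1 (xPrime p n)) (etaVec 1 (xPrime p n))) f)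
      ((((((1 - (p : ℝ)) / p : ℝ)) : ℂ) •
          ((hardyIsoMinus 1).toContinuousLinearMap ∘L V ∘L Dop ∘L Iop ∘L
            (ContinuousLinearMap.adjoint V) ∘L
            ContinuousLinearMap.adjoint (hardyIsoPlus 1).toContinuousLinearMap)) f) :=
  hasSum_rankOne_primeModel_diag hp V Iop Dop _ hV hI (primeDiag_single_eq Dop hD0 hD) f

end ModelDiag

end QuasiInner

end Literature.NumberTheory.ConnesConsani2021

end
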